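import Summits.BirchSwinnertonDyer.BirchSwinnertonDyer.Theorems.KolyvaginDepthDoorDepthTableKurihara
import Summits.BirchSwinnertonDyer.BirchSwinnertonDyer.Theorems.KolyvaginDepthDoorDepthTableSteinWuthrichRows10
import Summits.BirchSwinnertonDyer.BirchSwinnertonDyer.Theorems.KolyvaginDepthDoorDepthTableRowsIntrinsic5
import Summits.BirchSwinnertonDyer.BirchSwinnertonDyer.Theorems.Rank1ResidualIntModelSurjectivity
import Summits.BirchSwinnertonDyer.Rank1Residual.Supersingular.CountPointsFast
import Summits.BirchSwinnertonDyer.Rank1Residual.Additive.X4ThreeKuriharaCertKernel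
import HarnessLib

/-!
# Route `KolyvaginDepthDoor`, crux `KolyvaginDepthSupplyKN` (stmt-BirchSwinnertonDyer-22820) —
# DEPTH TABLE v17, E-SIDE TABLE (part 6: `664a1`, the one ADDITIVE curve of the table): `Ш(E/ℚ)[7] = 0` from the tree's
# Kurihara record `cert_664a1` @ `(7, 127·743)` (Kim 2026 Thm. 1.11 by name) — completing the `E`-side table: 18 / 18 curves

Helper file of the lead prover of line `levelone` (kdd-p1 g21; `--supports stmt-BirchSwinnertonDyer-22820
--as helper`); it closes nothing and BSD is NOT proved by it.

`664a1 = [0,0,0,−7,10]` (`N = 664 = 2³·83`) has ADDITIVE reduction at `2`, so the semistable surjectivity route (Serre Prop. 21)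
of the sibling files is unavailable; `ρ̄_{E,7}` onto is certified by Serre's Prop. 19 with three Frobenius witnesses on the
lineage's kernel point counts `#Ẽ(𝔽₃) = 7`, `#Ẽ(𝔽₅) = 10`. `5` is anomalous for `664a1` (`a_5 = −4`); at `p = 7`: `a_7 = −5` (good
ordinary, non-anomalous), record `(7, 127·743 = 94361, 2, 6)` (`KuriharaCertificates/RecordsN000651to000685`), `#Ẽ(𝔽₁₂₇) = 133 = 7·19`,
`#Ẽ(𝔽₇₄₃) = 700 = 7·100` (`49 ∤`), Kodaira–Néron at every `p ≥ 5` (`kodairaNeron_of_five_le`, additive-aware), `2 ≤ rank`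
(`KernelCerts001.C664a1.two_le_rank`). RESULT `C664a1.sha_inf_torsionBy_eq_bot_of_kuriharaClaim_7`: `Ш(664a1/ℚ)[7] = 0`, CONDITIONAL
on Kim Thm. 1.11, modularity, Mazur Cor. 4.1 BY NAME and the record's claim. With parts 1–5 and the two row files, the `E`-side
conjunct «`Ш(E)[p] = 0` at an admissible `p`» is now certificate-backed IN THE TREE for ALL 18 rank-two curves of conductor `≤ 1000`
(v13–v16 took it from Stein–Wuthrich 2013 Thm. 1.1 by name). Per curve; nothing class-wide; BSD is NOT proved by it.

References: [Kim2022StructureSelmer] Thm. 1.11; [Serre1972] §2.8 Prop. 19; [Mazur1978] Cor. 4.1; [SilvermanAEC2009] VII.3.1.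
-/

set_option linter.dupNamespace false

noncomputable section

open scoped Classical NumberField

namespace Summit.BirchSwinnertonDyer.BirchSwinnertonDyer.Theorems.KolyvaginDepthDoor

open Literature.NumberTheory.EllipticCurves Literature.NumberTheory.EllipticCurves.ModularForms
  WeierstrassCurve NumberField IsDedekindDomain
open Summit.BirchSwinnertonDyer.BirchSwinnertonDyer.Theorems
open Summit.BirchSwinnertonDyer.BirchSwinnertonDyer.Rank2Observatory
open Summit.BirchSwinnertonDyer.BirchSwinnertonDyer.Rank1Residual (IntModel.frobeniusTrace_eq
  IntModel.hasSurjectiveModNGaloisRep_of_intModel_of_serreWitnesses)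
open Summit.BirchSwinnertonDyer.Rank1Residual.Supersingular (natCard_point_eq_of_countPoints countPoints_eq_of_fast)
open Summit.BirchSwinnertonDyer.Rank1Residual.Additive (card_torsion_le_of_intModel_of_card
  isKolyvaginPrime_of_intModel_of_card isKolyvaginProduct_mul)

/-! ## `664a1` = `[0, 0, 0, -7, 10]` at `p = 7`: record `cert_664a1` @ `(7, 127·743)`, `δ̃ ≡ 6` -/

namespace C664a1

/-- `#Ẽ(𝔽_7) = 13` for `664a1` (`a_7 = -5`: good ordinary, non-anomalous at `7`), kernel-decided (`countPointsFast`). [cite: CremonaAlgorithms1997, Table 1 (664a1)] -/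
theorem card_7 :
    Nat.card (((⟨0, 0, 0, -7, 10⟩ : WeierstrassCurve ℤ).map (Int.castRingHom (ZMod 7))).toAffine.Point) = 13 :=
  haveI : Fact (Nat.Prime 7) := ⟨by norm_num⟩
  natCard_point_eq_of_countPoints 0 0 0 (-7) 10 7 (by norm_num) (by decide +kernel) (n := 13)
    (countPoints_eq_of_fast (by decide +kernel))

/-- `#Ẽ(𝔽_127) = 133` for `664a1` (`127 ≡ 1`, `a_127 = -5 ≡ 2 (mod 7)`, `7² ∤ 133`), kernel-decided (`countPointsFast`). [cite: CremonaAlgorithms1997, Table 1 (664a1)] -/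
theorem card_127 :
    Nat.card (((⟨0, 0, 0, -7, 10⟩ : WeierstrassCurve ℤ).map (Int.castRingHom (ZMod 127))).toAffine.Point) = 133 :=
  haveI : Fact (Nat.Prime 127) := ⟨by norm_num⟩
  natCard_point_eq_of_countPoints 0 0 0 (-7) 10 127 (by norm_num) (by decide +kernel) (n := 133)
    (countPoints_eq_of_fast (by decide +kernel))

/-- `#Ẽ(𝔽_743) = 700` for `664a1` (`743 ≡ 1`, `a_743 = 44 ≡ 2 (mod 7)`, `7² ∤ 700`), kernel-decided (`countPointsFast`). [cite: CremonaAlgorithms1997, Table 1 (664a1)] -/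
theorem card_743 :
    Nat.card (((⟨0, 0, 0, -7, 10⟩ : WeierstrassCurve ℤ).map (Int.castRingHom (ZMod 743))).toAffine.Point) = 700 :=
  haveI : Fact (Nat.Prime 743) := ⟨by norm_num⟩
  natCard_point_eq_of_countPoints 0 0 0 (-7) 10 743 (by norm_num) (by decide +kernel) (n := 700)
    (countPoints_eq_of_fast (by decide +kernel))

/-- **`7` is good ordinary for `664a1`** (`7 ∤ Δ`, `a_7 = -5`). [cite: CremonaAlgorithms1997, Table 1 (664a1)] -/
theorem goodOrdinary_7 :
    haveI := Fact.mk (by norm_num : Nat.Prime 7); haveI := isGloballyMinimal_c664a1;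
    ((⟨0, 0, 0, -7, 10⟩ : WeierstrassCurve ℤ).map (Int.castRingHom ℚ)).HasGoodReductionAtPrime 7 ∧ ¬ ((7 : ℕ) : ℤ) ∣ ((⟨0, 0, 0, -7, 10⟩ : WeierstrassCurve ℤ).map (Int.castRingHom ℚ)).frobeniusTrace 7 := by
  haveI := Fact.mk (by norm_num : Nat.Prime 7)
  haveI := isElliptic_c664a1
  haveI := isGloballyMinimal_c664a1
  exact goodOrdinary_of_intModel_certificate intModel 7 (by decide +kernel) (n := 13) card_7 (by decide +kernel)

/-- **`ρ̄_{E,7}` is surjective for `664a1`** (additive at `2`, so Serre's Prop. 21 is unavailable — Serre's Prop. 19 instead,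
tree theorem `IntModel.hasSurjectiveModNGaloisRep_of_intModel_of_serreWitnesses`): Frobenius witnesses i) `q = 3`, `a = −3`: `a² − 4q ≡ 4`
a non-zero square mod `7`, `a ≢ 0`; ii) `q = 5`, `a = −4`: `a² − 4q ≡ 3` a non-square, `a ≢ 0`; iii) `q = 3`: `u = a²/q ≡ 3`,
`u ∉ {0,1,2,4}`, `u² − 3u + 1 ≢ 0` — all kernel-decided on the lineage's counts `card_3`, `card_5`. [cite: Serre1972, §2.8 Prop. 19] -/
theorem hasSurjectiveModNGaloisRep_7 :
    haveI := isElliptic_c664a1;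
    ((⟨0, 0, 0, -7, 10⟩ : WeierstrassCurve ℤ).map (Int.castRingHom ℚ)).HasSurjectiveModNGaloisRep (7 : ℕ) := by
  have hi : IsSquare (((((3 : ℕ) : ℤ) + 1 - (7 : ℕ) : ℤ) : ZMod 7) ^ 2 - 4 * ((3 : ℕ) : ZMod 7)) ∧
      ((((3 : ℕ) : ℤ) + 1 - (7 : ℕ) : ℤ) : ZMod 7) ^ 2 - 4 * ((3 : ℕ) : ZMod 7) ≠ 0 ∧
        ((((3 : ℕ) : ℤ) + 1 - (7 : ℕ) : ℤ) : ZMod 7) ≠ 0 := by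
    decide +kernel
  have hii : ¬ IsSquare (((((5 : ℕ) : ℤ) + 1 - (10 : ℕ) : ℤ) : ZMod 7) ^ 2 - 4 * ((5 : ℕ) : ZMod 7)) ∧
      ((((5 : ℕ) : ℤ) + 1 - (10 : ℕ) : ℤ) : ZMod 7) ≠ 0 := by
    decide +kernel
  have hiii : ∃ u : ZMod 7, ((((3 : ℕ) : ℤ) + 1 - (7 : ℕ) : ℤ) : ZMod 7) ^ 2 = u * ((3 : ℕ) : ZMod 7) ∧
      u ≠ 0 ∧ u ≠ 1 ∧ u ≠ 2 ∧ u ≠ 4 ∧ u ^ 2 - 3 * u + 1 ≠ 0 := ⟨3, by decide +kernel⟩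
  haveI := Fact.mk (by norm_num : Nat.Prime 3)
  haveI := Fact.mk (by norm_num : Nat.Prime 5)
  haveI := Fact.mk (by norm_num : Nat.Prime 7)
  haveI := isElliptic_c664a1
  haveI := isGloballyMinimal_c664a1
  exact IntModel.hasSurjectiveModNGaloisRep_of_intModel_of_serreWitnesses intModel 7 (by norm_num) 3 5 3
    (by norm_num) (by norm_num) (by norm_num) (by decide +kernel) (by decide +kernel) (by decide +kernel)
    (n₁ := 7) (n₂ := 10) (n₃ := 7) card_3 card_5 card_3 hi hii hiii

/-- **`7` is non-anomalous for `664a1`**: `a_7 − 1 = -6`. [cite: SilvermanAEC2009, VII.3 Prop. 3.1] -/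
theorem nonAnomalous_7 :
    haveI := isGloballyMinimal_c664a1; haveI := Fact.mk (by norm_num : Nat.Prime 7);
    ¬ ((7 : ℕ) : ℤ) ∣ ((⟨0, 0, 0, -7, 10⟩ : WeierstrassCurve ℤ).map (Int.castRingHom ℚ)).frobeniusTrace 7 - 1 := by
  haveI := isElliptic_c664a1; haveI := isGloballyMinimal_c664a1; haveI := Fact.mk (by norm_num : Nat.Prime 7)
  rw [IntModel.frobeniusTrace_eq intModel card_7]
  decide

/-- **`94361 = 127·743` is a cyclic Kolyvagin level for `(664a1, 7)`** — the level of the tree record `cert_664a1` at `p = 7`.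
[cite: Kim2022StructureSelmer, §1.2.2 (PDF p. 5)] -/
theorem isCyclicKolyvaginLevel_7_94361 :
    haveI := isGloballyMinimal_c664a1; haveI := Fact.mk (by norm_num : Nat.Prime 7);
    IsCyclicKolyvaginLevel ((⟨0, 0, 0, -7, 10⟩ : WeierstrassCurve ℤ).map (Int.castRingHom ℚ)) 7 94361 := by
  haveI := isElliptic_c664a1
  haveI := isGloballyMinimal_c664a1
  haveI := Fact.mk (by norm_num : Nat.Prime 7)
  haveI : Fact (Nat.Prime 127) := ⟨by norm_num⟩
  haveI : Fact (Nat.Prime 743) := ⟨by norm_num⟩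
  have h₁ : Kato.IsKolyvaginPrime ((⟨0, 0, 0, -7, 10⟩ : WeierstrassCurve ℤ).map (Int.castRingHom ℚ)) 7 1 127 :=
    isKolyvaginPrime_of_intModel_of_card intModel 7 1 127 (by norm_num) (by decide +kernel) (by decide) card_127
      (by norm_num)
  have h₂ : Kato.IsKolyvaginPrime ((⟨0, 0, 0, -7, 10⟩ : WeierstrassCurve ℤ).map (Int.castRingHom ℚ)) 7 1 743 :=
    isKolyvaginPrime_of_intModel_of_card intModel 7 1 743 (by norm_num) (by decide +kernel) (by decide) card_743
      (by norm_num)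
  refine ⟨by simpa using isKolyvaginProduct_mul h₁ h₂ (by norm_num), fun ℓ hℓ hdvd ↦ ?_⟩
  rw [show (94361 : ℕ) = 127 * 743 from rfl] at hdvd
  rcases (Nat.Prime.dvd_mul hℓ.out).mp hdvd with h | h
  · obtain rfl := (Nat.prime_dvd_prime_iff_eq hℓ.out (by norm_num)).mp h
    exact card_torsion_le_of_intModel_of_card intModel 7 127 card_127 (by norm_num)
  · obtain rfl := (Nat.prime_dvd_prime_iff_eq hℓ.out (by norm_num)).mp h
    exact card_torsion_le_of_intModel_of_card intModel 7 743 card_743 (by norm_num)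

/-- **`Ш(664a1/ℚ)[7] = 0` FROM THE TREE RECORD `cert_664a1` @ `(7, 127·743)`** (Kurihara currency): granted Kim 2026 Thm. 1.11
(`hKim`), modularity (`hnf`), Mazur 1978 Cor. 4.1 (`hMaz`) BY NAME and the record's CLAIM `hδ` (read at level `N_E` through
`KuriharaCertificates.Record.Claim`), `#Sel_7(E/ℚ) ≤ 7² = 7^rank` and so `Ш(E/ℚ)[7] = 0` (`7` good ordinary `goodOrdinary_7`,
`ρ̄_{E,7}` onto `hasSurjectiveModNGaloisRep_7` (Serre Prop. 19 witnesses), `nonAnomalous_7`, Kodaira–Néron `kodairaNeron_of_five_le 7`, `2 ≤ rank` `KernelCerts001.C664a1.two_le_rank`).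
CONDITIONAL on the three named facts and the claim; per curve; BSD is not proved by it.
[cite: Kim2022StructureSelmer, Thm. 1.11 (PDF p. 8)] [cite: Mazur1978, Cor. 4.1] [cite: CremonaAlgorithms1997, Table 1 (664a1)] -/
theorem sha_inf_torsionBy_eq_bot_of_kuriharaClaim_7
    (hKim : Kim2022_card_selmerGroup_le_pow_of_kuriharaNumber_ne_zero)
    (hnf : exists_isNewformOf) (hMaz : mazur_not_dvd_maninConstant_of_odd)
    (hδ : haveI := isElliptic_c664a1; haveI := isGloballyMinimal_c664a1;
      haveI : NeZero (((⟨0, 0, 0, -7, 10⟩ : WeierstrassCurve ℤ).map (Int.castRingHom ℚ)).conductorNorm ℤ) := neZero_conductorNorm_of_isElliptic _;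
      haveI := Fact.mk (by norm_num : Nat.Prime 7);
      ∀ (D : ModularParametrizationData ((⟨0, 0, 0, -7, 10⟩ : WeierstrassCurve ℤ).map (Int.castRingHom ℚ)) (((⟨0, 0, 0, -7, 10⟩ : WeierstrassCurve ℤ).map (Int.castRingHom ℚ)).conductorNorm ℤ)), ¬ ((7 : ℕ) : ℤ) ∣ D.maninConstant →
        (∃ u : ℚ, ‖(u : ℚ_[7])‖ = 1 ∧ ((⟨0, 0, 0, -7, 10⟩ : WeierstrassCurve ℤ).map (Int.castRingHom ℚ)).realPeriodRat = u * plusPeriod D.f) →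
        ∃ ψ : (ℓ : ℕ) → (ZMod ℓ)ˣ →* Multiplicative (ZMod 7),
          (∀ ℓ ∈ (94361 : ℕ).primeFactors, Function.Surjective (ψ ℓ)) ∧ kuriharaNumber D.f 7 94361 ψ ≠ 0) :
    haveI := isElliptic_c664a1; haveI := isGloballyMinimal_c664a1; haveI := Fact.mk (by norm_num : Nat.Prime 7);
    (((⟨0, 0, 0, -7, 10⟩ : WeierstrassCurve ℤ).map (Int.castRingHom ℚ)).sha ⊓ AddSubgroup.torsionBy ((⟨0, 0, 0, -7, 10⟩ : WeierstrassCurve ℤ).map (Int.castRingHom ℚ)).galH1 ((7 : ℕ) : ℤ) : AddSubgroup _) = ⊥ := by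
  haveI := isElliptic_c664a1
  haveI := isGloballyMinimal_c664a1
  haveI iNZ : NeZero (((⟨0, 0, 0, -7, 10⟩ : WeierstrassCurve ℤ).map (Int.castRingHom ℚ)).conductorNorm ℤ) := neZero_conductorNorm_of_isElliptic _
  haveI := Fact.mk (by norm_num : Nat.Prime 7)
  haveI : NeZero (94361 : ℕ) := ⟨by norm_num⟩
  have hν : (94361 : ℕ).primeFactors.card ≤ ((⟨0, 0, 0, -7, 10⟩ : WeierstrassCurve ℤ).map (Int.castRingHom ℚ)).mordellWeilRank := by
    refine le_trans (le_of_eq ?_) KernelCerts001.C664a1.two_le_rank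
    rw [show (94361 : ℕ) = 127 * 743 from rfl, Nat.primeFactors_mul (by norm_num) (by norm_num),
      Nat.Prime.primeFactors (by norm_num), Nat.Prime.primeFactors (by norm_num)]
    decide
  exact sha_inf_torsionBy_eq_bot_of_kuriharaClaim hKim hnf hMaz _ 7 (by norm_num) goodOrdinary_7.1 goodOrdinary_7.2
    hasSurjectiveModNGaloisRep_7 nonAnomalous_7 (kodairaNeron_of_five_le 7 (by norm_num)) 94361 isCyclicKolyvaginLevel_7_94361 hν hδ

end C664a1

end Summit.BirchSwinnertonDyer.BirchSwinnertonDyer.Theorems.KolyvaginDepthDoor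

end
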